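import Literature.MathematicalPhysics.QuantumFieldTheory.Balaban1983to89.B9Eq386BondPropagatorTwoBackgroundLetterTower
import Literature.MathematicalPhysics.QuantumFieldTheory.Balaban1983to89.B9Eq347TowerLaddersL2

/-!
# `Balaban1983to89.B9Eq386BondPropagatorTwoBackgroundL2Tower` — T. Bałaban, *Propagators for lattice gauge theories in a background field*, Commun. Math. Phys. **99** (1985)
# 389–434 [Balaban1985BackgroundPropagators] (3.84)–(3.86) p. 407, Thm 3.3 p. 399 (*«|G(U)f|, … ≤ B₀ … |f|»*), Thm 3.4 p. 400, (3.47) p. 398, Thm 3.11 p. 416: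
# **THE TWO-BACKGROUND LADDER OF THE `k`-LEVEL BOND PROPAGATOR `G₁,k` AT THE FLAT BASE AS A SUP ROW AND IN `L²`, LATTICE-FREE** — `∃ α₀ K` BEFORE `n, η, m, U`:
# `‖(G₁,k(U)f − G₁,k(1)f)(b)‖ ≤ K·α·‖f‖_∞` for EVERY `f` of the fine bond carrier, and `‖G₁,k(U)f − G₁,k(1)f‖_{L²(c₀)} ≤ K·α·‖f‖_{L²(c₀)}` (symmetric bridge) — the bond analogue of
# gen 100's `B9Eq347TowerLaddersL2.exists_norm_GpOfUk_sub_flat_le` (`G′_k`) and `exists_norm_RofUk_sub_flat_le` (`R_k`)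

statement-level skeleton of published theorems with citation tags; proofs where landed; nothing here is a claim about the Yang–Mills mass gap

CITATION HEADER (lean-in-tree rule).  Audit cell `pub-balaban`, sub-cell `t4`, BINDER row NE9; filed by NE9 crux-team LEAF PROVER 01 (`b2b-balaban-t4-ne9-formalise-leaf-01`, gen 100;
ROUTE (J′-G) «bond storey», memo `t4/b2b-balaban-t4-ne9-formalise-leaf-01/g100/ROUTE-JprimeG-BOND-STOREY-g100.md` §B5).  Imports this lineage's
`B9Eq386BondPropagatorTwoBackgroundLetterTower` (the local letter `exists_letter_G1k_sub_flat`) and `B9Eq347TowerLaddersL2` (the symmetric `ℓ^∞ → L²` bridge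
`norm_le_of_isSymmetric_of_supLetter`; through it ne9-leaf-01's `B9Eq3124GaugeModes.greenK_isSymmetric`); ne9-leaf-01's `B9Eq349BlockMultipliers` (`exists_block_clm_family`,
`sum_block_apply`), `B4Sect5Torus.torusSum_le`, `B9Eq326OperatorTower.laplaceAk_isSymmetric`.  Source READ first-hand in the held text layer `paper:balaban1985-cmp99-background-propagators`
p. 407 (3.84)–(3.86), p. 399 Thm 3.3, p. 400 Thm 3.4, p. 398 (3.47).  NOTHING of print's proofs is reproduced: [folklore] block decomposition + one lattice sum + the spectral bridge.

WHAT IS PROVED (sorry-free; proof lane — 0 `def`; [folklore]).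
* §0 `equiv_finset_sum` (the carrier identification commutes with finite sums); **`G1k_isSymmetric`** — `G₁,k(U) = Δ_{a,k}(U)⁻¹` is symmetric for a unitary `U` and a `*`-trace
  (`laplaceAk_isSymmetric` + `greenK_isSymmetric`).
* §1 **`exists_supRow_G1k_sub_flat`** — `∃ α₀ K`: along the whole class and for EVERY `f` with `‖f(b′)‖ ≤ F`: `‖(G₁,k(U)f − G₁,k(1)f)(b)‖ ≤ K·α·F` — the letter of
  `exists_letter_G1k_sub_flat` summed over the source blocks (`f = Σ_v 1_{Π⁻¹(v)}f`, `Σ_v e^{−κ d_m(u,v)} ≤ K_d(κ)`): print's «|G(U)f − G(1)f| ≤ B·α·|f|» shape of Thm 3.4, in the sup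
  currency, constants free of `n, η, m`.
* §2 **`exists_norm_G1k_sub_flat_le`** — the same in `L²(c₀)`: `‖G₁,k(U)f − G₁,k(1)f‖ ≤ K·α·‖f‖` for EVERY `f` (`G₁,k(U) − G₁,k(1)` is symmetric; `‖T‖_{L²} ≤ ‖T‖_{ℓ^∞→ℓ^∞}` for
  symmetric `T` on uniform weights — the bridge of gen 99's J-26).  The lattice-free form of the OWNER's fixed-lattice `δ_G`-type letters for the bond propagator at the flat point.
HONEST SCOPE.  Composition BY NAME on the cell's MODEL rows (O-NE9-1; #5 UNRULED); constants crude; flat base only; first-order identity only; nothing of [B9] Thm 3.3 ∕ 3.4 asserted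
as printed; «NE9 ⇐ the named binders»; NE9 NOT PRINTED ∕ NOT PROVED; spine PROVED 0∕9; rung (B)+1 on a finite T⁴ — NOT infinite volume, NOT mass gap, NOT BetaPertH, NOT Clay.  HONEST
DEPENDENCY: continuum YM on T⁴ ⇐ BetaPertH ∧ nine spine estimates (0/9 proved); BetaPertH ⇐ (D1) ∧ (D4) ∧ CAP+tail; G-an2-4 gates asym, D1 and NE2/3/4.  NEW file; nothing modified.
Net new unproved facts: 0.
-/

noncomputable section

open scoped InnerProductSpace ComplexConjugate BigOperators

namespace Literature.MathematicalPhysics.QuantumFieldTheory.Balaban1983to89.B9Eq386BondPropagatorTwoBackgroundL2Tower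

open B4Sect5Torus (TSite tdist tdist_nonneg torusSum_le)
open B4Sect5Proof (latticeConst latticeConst_nonneg)
open B9SectCLatticeCarrier (Bond bpos shift)
open B9Eq311L2Pairing (WL2)
open B9Eq319QprimeTorus (blockCoord)
open B7Prop1Explicit (U1 Wcx boxVec)
open B11Eq103H1Complex (SiteL2K BondL2K)
open B9Eq310DeltaPrime (plaqHolU)
open B9Eq310HessianOperator (adTransportW)
open B9Eq315QTorus (perCfg cornerSite)
open B9Eq315QTower (towerP UlevOf)
open B9Eq315QTowerFlat (perCfg_UlevOf_one_mem_U1 norm_Wcx_UlevOf_one_sub_one_le)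
open B9Eq316TowerFlatIsOneStep (towerP_eq_fineP_pow siteCast)
open B9Eq326OperatorTower (laplaceAk laplaceAk_isSymmetric G1k)
open B9Eq324DeltaPrimeATower (laplacePrimeAk)
open B9Eq3124GaugeModes (greenK_isSymmetric)
open B9Eq349BlockMultipliers (exists_block_clm_family sum_block_apply)
open B9Eq347TowerLaddersL2 (norm_le_of_isSymmetric_of_supLetter)
open B9Eq386BondPropagatorTwoBackgroundLetterTower (exists_letter_G1k_sub_flat)

/-! ## §0 Two small facts -/

/-- the carrier identification commutes with finite sums, pointwise. [folklore] [cite: Balaban1985BackgroundPropagators, (3.11) p.392] -/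
theorem equiv_finset_sum {𝕜 : Type*} [RCLike 𝕜] {X : Type*} {w : X → ℝ} {V : Type*} [NormedAddCommGroup V] [InnerProductSpace 𝕜 V]
    {ι : Type*} (s : Finset ι) (g : ι → WL2 𝕜 w V) (x : X) :
    WL2.equiv 𝕜 w V (∑ i ∈ s, g i) x = ∑ i ∈ s, WL2.equiv 𝕜 w V (g i) x := by
  have e := congrFun (map_sum (WL2.linearEquiv 𝕜 𝕜 w (V := V)) g s) x
  simp only [WL2.linearEquiv_apply, Finset.sum_apply] at e
  exact e

variable {d : ℕ} (hd : 1 ≤ d) (L : ℕ) [NeZero L] (hL : 1 ≤ L) (hL3 : 3 ≤ L)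
  {𝔸 : Type*} [NormedRing 𝔸] [NormedAlgebra ℂ 𝔸] [CompleteSpace 𝔸] [NormOneClass 𝔸] [StarRing 𝔸] [NormedStarGroup 𝔸] [StarModule ℂ 𝔸] [FiniteDimensional ℂ 𝔸]
  {W : Type*} [NormedAddCommGroup W] [InnerProductSpace ℂ W] [FiniteDimensional ℂ W] (φ : W ≃ₗ[ℂ] 𝔸)
  {Mφ Mφ' : ℝ} (hMφ : 0 ≤ Mφ) (hMφ' : 0 ≤ Mφ') (hφ : ∀ w, ‖φ w‖ ≤ Mφ * ‖w‖) (hφ' : ∀ X, ‖φ.symm X‖ ≤ Mφ' * ‖X‖) (hstar : ∀ X : 𝔸, ‖star X‖ ≤ ‖X‖)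
  {a : ℝ} (ha : 0 < a) {a' : ℝ} (ha' : 0 < a') {r : ℝ} (hr0 : 0 ≤ r) (hr1 : r < 1)
  (τ : 𝔸 →ₗ[ℂ] ℂ) {Cτ : ℝ} (hτ : ∀ X, ‖τ X‖ ≤ Cτ * ‖X‖) (hCτ : 0 ≤ Cτ) {Mτ : ℝ} (hτm : ∀ X Y : 𝔸, ‖τ (X * Y)‖ ≤ Mτ * ‖X‖ * ‖Y‖) (hMτ : 0 ≤ Mτ)
  {ρw : ℝ} (hρw : 0 ≤ ρw)
  (hτ₁ : ∀ X : 𝔸, τ (star X) = conj (τ X)) (hτ₂ : ∀ X Y : 𝔸, τ (X * Y) = τ (Y * X)) (hφτ : ∀ X Y : 𝔸, ⟪φ.symm X, φ.symm Y⟫_ℂ = τ (star X * Y))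
  {ι : Type} [Fintype ι] [DecidableEq ι] (b : Module.Basis ι ℝ 𝔸) {M₂ : ℝ} (hM₂ : 0 ≤ M₂) (hrepr : ∀ (v : 𝔸) (i : ι), |b.repr v i| ≤ M₂ * ‖v‖)
  (AQ : ℝ)

include hτ₁ hτ₂ hφτ in
omit [NormedStarGroup 𝔸] [FiniteDimensional ℂ 𝔸] in
/-- **`G₁,k(U) = Δ_{a,k}(U)⁻¹` IS SYMMETRIC** for a unitary background and a `*`-trace compatible with the fibre norming (`laplaceAk_isSymmetric`; the inverse of a positive
symmetric operator on a finite-dimensional space is symmetric, `greenK_isSymmetric`). [folklore] [cite: Balaban1985BackgroundPropagators, (3.26) p.395, Thm 3.11 p.416] -/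
theorem G1k_isSymmetric (n : ℕ) (η : ℝ) {c₀ c₁ : ℝ} [Fact (0 < c₀)] [Fact (0 < c₁)] (m : Fin d → ℕ) [∀ i, NeZero (m i)]
    (U : Bond d (towerP L m (n + 1)) → 𝔸ˣ) (αU : ℕ → ℝ) (hα1 : ∀ j, αU j ≤ 1 / 64)
    (hU1 : ∀ (j : ℕ) (x : B7Prop1Explicit.Site d) (k : Fin d), perCfg (towerP L m (j + 1)) (UlevOf L m (n + 1) U j) x k ∈ U1 𝔸)
    (hreg : ∀ (j : ℕ) (y : TSite d (towerP L m j)) (k : Fin d) (ρ' : Fin d → Fin L),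
      ‖((Wcx L (perCfg (towerP L m (j + 1)) (UlevOf L m (n + 1) U j)) (cornerSite L y) k (boxVec L ρ') : 𝔸ˣ) : 𝔸) - 1‖ ≤ αU j)
    (hUst : ∀ bd, star (U bd : 𝔸) = (((U bd)⁻¹ : 𝔸ˣ) : 𝔸))
    (hpos : ∀ x : BondL2K ℂ d (towerP L m (n + 1)) c₀ W, x ≠ 0 →
      0 < RCLike.re ⟪x, laplaceAk L m n φ η U hL αU hα1 hU1 hreg τ (c₀ := c₀) (c₁ := c₁) a x⟫_ℂ) :
    (G1k L m n φ η U hL αU hα1 hU1 hreg τ (c₀ := c₀) (c₁ := c₁) hpos).IsSymmetric := by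
  have hs := laplaceAk_isSymmetric L m n φ η U hL αU hα1 hU1 hreg τ (c₀ := c₀) (c₁ := c₁) hUst hτ₁ hτ₂ hφτ a
  unfold G1k B11Eq103H1Complex.G1LatticeK B11Eq103H1Complex.G1K
  unfold laplaceAk B11Eq103H1Complex.laplaceALatticeK at hs
  exact greenK_isSymmetric _ hs

/-! ## §1 The sup row: `|G₁,k(U)f − G₁,k(1)f| ≤ K·α·|f|` for every `f`, lattice-free -/

include hd hL hL3 hMφ hMφ' hφ hφ' hstar ha ha' hr0 hr1 hτ hCτ hτm hMτ hρw hτ₁ hτ₂ hφτ hM₂ hrepr in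
set_option maxHeartbeats 1600000 in
/-- **THE SUP ROW OF `G₁,k(U) − G₁,k(1)`, LATTICE-FREE** — `∃ α₀ > 0, K ≥ 0` BEFORE `n, η, m, U`: along the whole class of the bond storey and for EVERY `f` of the fine bond carrier with
`‖f(b′)‖ ≤ F`: `‖(G₁,k(U)f − G₁,k(1)f)(b)‖ ≤ K·α·F` (the letter `exists_letter_G1k_sub_flat` summed over the source blocks, `Σ_v e^{−κ d_m(u,v)} ≤ K_d(κ)`). [folklore]
[cite: Balaban1985BackgroundPropagators, Thm 3.4 p.400, Thm 3.3 p.399, (3.47) p.398, (3.84)–(3.86) p.407] -/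
theorem exists_supRow_G1k_sub_flat :
    ∃ α₀ K : ℝ, 0 < α₀ ∧ 0 ≤ K ∧
      ∀ (n : ℕ) (η : ℝ), η * (L : ℝ) ^ (n + 1) = 1 →
      ∀ (c₀ c₁ : ℝ) [Fact (0 < c₀)] [Fact (0 < c₁)], c₀ * ((L : ℝ) ^ (n + 1)) ^ d = c₁ → |η| ^ d / c₀ ≤ ρw →
      ∀ (m : Fin d → ℕ) [∀ i, NeZero (m i)], (∀ i, 1 ≤ m i) → ∀ (U : Bond d (towerP L m (n + 1)) → 𝔸ˣ) (α : ℝ), 0 ≤ α → α ≤ α₀ →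
        (∀ bd, U bd ∈ U1 𝔸) → (∀ bd, ‖(U bd : 𝔸) - 1‖ ≤ α * η) →
        (∀ (x : TSite d (towerP L m (n + 1))) (μ ν : Fin d), ‖(U (shift ν x, μ) : 𝔸) - (U (x, μ) : 𝔸)‖ ≤ α * η ^ 2) →
        (∀ p : B9SectCLatticeCarrier.Plaq d (towerP L m (n + 1)), ‖(plaqHolU U p : 𝔸) - 1‖ ≤ α * η ^ 2) →
      ∀ (hUst : ∀ bd, star (U bd : 𝔸) = (((U bd)⁻¹ : 𝔸ˣ) : 𝔸))
        (αU : ℕ → ℝ), (∀ j, 0 ≤ αU j) → ∀ (hα1 : ∀ j, αU j ≤ 1 / 64), (∑ j ∈ Finset.range (n + 1), αU j ≤ AQ) →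
        ∀ (hU1 : ∀ (j : ℕ) (x : B7Prop1Explicit.Site d) (k : Fin d), perCfg (towerP L m (j + 1)) (UlevOf L m (n + 1) U j) x k ∈ U1 𝔸)
        (hreg : ∀ (j : ℕ) (y : TSite d (towerP L m j)) (k : Fin d) (ρ' : Fin d → Fin L),
          ‖((Wcx L (perCfg (towerP L m (j + 1)) (UlevOf L m (n + 1) U j)) (cornerSite L y) k (boxVec L ρ') : 𝔸ˣ) : 𝔸) - 1‖ ≤ αU j),
      ∀ (εU : ℕ → ℝ), (∀ j, 0 ≤ εU j) → (∀ j, εU j ≤ 1) → (∀ j < n + 1, εU j ≤ α * r ^ j) →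
        (∀ (j : ℕ) (bd : Bond d (towerP L m (j + 1))), ‖(UlevOf L m (n + 1) U j bd : 𝔸) - 1‖ ≤ εU j) →
        (∀ (j : ℕ) (bd : Bond d (towerP L m (j + 1))), UlevOf L m (n + 1) U j bd ∈ U1 𝔸) →
        (∀ (j : ℕ) (bd : Bond d (towerP L m (j + 1))) (w : W), ‖adTransportW φ (UlevOf L m (n + 1) U j) bd w‖ ≤ ‖w‖) →
      ∀ (hposU' : ∀ x : SiteL2K ℂ d (towerP L m (n + 1)) c₀ W, x ≠ 0 → 0 < RCLike.re ⟪x, laplacePrimeAk L m n φ η U a' (c₁ := c₁) x⟫_ℂ)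
        (hposU : ∀ x : BondL2K ℂ d (towerP L m (n + 1)) c₀ W, x ≠ 0 →
          0 < RCLike.re ⟪x, laplaceAk L m n φ η U hL αU hα1 hU1 hreg τ (c₀ := c₀) (c₁ := c₁) a x⟫_ℂ)
        (hpos'₁ : ∀ x : SiteL2K ℂ d (towerP L m (n + 1)) c₀ W, x ≠ 0 →
          0 < RCLike.re ⟪x, laplacePrimeAk L m n φ η (fun _ : Bond d (towerP L m (n + 1)) => (1 : 𝔸ˣ)) a' (c₁ := c₁) x⟫_ℂ)
        (hpos₁ : ∀ x : BondL2K ℂ d (towerP L m (n + 1)) c₀ W, x ≠ 0 →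
          0 < RCLike.re ⟪x, laplaceAk L m n φ η (fun _ : Bond d (towerP L m (n + 1)) => (1 : 𝔸ˣ)) hL (fun _ => 0) (fun _ => by norm_num)
            (perCfg_UlevOf_one_mem_U1 L m (n + 1)) (norm_Wcx_UlevOf_one_sub_one_le L m (n + 1) (fun _ => 0) (fun _ => le_rfl)) τ
            (c₀ := c₀) (c₁ := c₁) a x⟫_ℂ)
        (f : BondL2K ℂ d (towerP L m (n + 1)) c₀ W) (F : ℝ), (∀ b', ‖WL2.equiv ℂ (fun _ : Bond d (towerP L m (n + 1)) => c₀) W f b'‖ ≤ F) →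
      ∀ bd : Bond d (towerP L m (n + 1)),
        ‖WL2.equiv ℂ (fun _ : Bond d (towerP L m (n + 1)) => c₀) W
            (G1k L m n φ η U hL αU hα1 hU1 hreg τ (c₀ := c₀) (c₁ := c₁) hposU f -
              G1k L m n φ η (fun _ : Bond d (towerP L m (n + 1)) => (1 : 𝔸ˣ)) hL (fun _ => 0) (fun _ => by norm_num)
                (perCfg_UlevOf_one_mem_U1 L m (n + 1)) (norm_Wcx_UlevOf_one_sub_one_le L m (n + 1) (fun _ => 0) (fun _ => le_rfl)) τ
                (c₀ := c₀) (c₁ := c₁) hpos₁ f) bd‖ ≤ K * α * F := by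
  classical
  obtain ⟨α₀, K, κ, hα₀, hK, hκ, H⟩ :=
    exists_letter_G1k_sub_flat hd L hL hL3 φ hMφ hMφ' hφ hφ' hstar ha ha' hr0 hr1 τ hτ hCτ hτm hMτ hρw hτ₁ hτ₂ hφτ b hM₂ hrepr AQ
  set S : ℝ := latticeConst d κ with hS
  have hS0 : 0 ≤ S := latticeConst_nonneg d hκ.le
  refine ⟨α₀, K * S, hα₀, mul_nonneg hK hS0, ?_⟩
  intro n η hηL c₀ c₁ _ _ hw hρ m _ hm U α hα hαle hUb hUη hUw hpl hUst αU hα0U hα1 hAQ hU1 hreg εU hε0 hε1 hεr hlev hlev1 hRlev hposU' hposU hpos'₁ hpos₁ f F hfF bd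
  have hF : 0 ≤ F := (norm_nonneg _).trans (hfF bd)
  set piB : Bond d (towerP L m (n + 1)) → TSite d m := fun b' => blockCoord (L ^ (n + 1)) m (siteCast (towerP_eq_fineP_pow L m (n + 1)) (bpos b')) with hpiB
  set GU := G1k L m n φ η U hL αU hα1 hU1 hreg τ (c₀ := c₀) (c₁ := c₁) hposU with hGU
  set G1 := G1k L m n φ η (fun _ : Bond d (towerP L m (n + 1)) => (1 : 𝔸ˣ)) hL (fun _ => 0) (fun _ => by norm_num)
    (perCfg_UlevOf_one_mem_U1 L m (n + 1)) (norm_Wcx_UlevOf_one_sub_one_le L m (n + 1) (fun _ => 0) (fun _ => le_rfl)) τ (c₀ := c₀) (c₁ := c₁) hpos₁ with hG1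
  -- the block decomposition of the source
  obtain ⟨P, hP⟩ := exists_block_clm_family (𝕜 := ℂ) (w := fun _ : Bond d (towerP L m (n + 1)) => c₀) (V := W) piB
  have hdec : GU f - G1 f = ∑ v, (GU (P v f) - G1 (P v f)) := by
    conv_lhs => rw [← sum_block_apply hP f]
    rw [map_sum, map_sum, Finset.sum_sub_distrib]
  -- each block source obeys the letter
  have hblk : ∀ v, ‖WL2.equiv ℂ (fun _ : Bond d (towerP L m (n + 1)) => c₀) W (GU (P v f) - G1 (P v f)) bd‖ ≤
      K * α * Real.exp (-(κ * tdist m (piB bd) v)) * F := by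
    intro v
    refine H n η hηL c₀ c₁ hw hρ m hm U α hα hαle hUb hUη hUw hpl hUst αU hα0U hα1 hAQ hU1 hreg εU hε0 hε1 hεr hlev hlev1 hRlev hposU' hposU hpos'₁ hpos₁
      v (P v f) F (fun b' hb' => ?_) (fun b' => ?_) bd
    · rw [hP, if_neg hb']
    · rw [hP]
      split_ifs
      · exact hfF b'
      · rw [norm_zero]; exact hF
  rw [hdec, equiv_finset_sum]
  calc ‖∑ v, WL2.equiv ℂ (fun _ : Bond d (towerP L m (n + 1)) => c₀) W (GU (P v f) - G1 (P v f)) bd‖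
      ≤ ∑ v, ‖WL2.equiv ℂ (fun _ : Bond d (towerP L m (n + 1)) => c₀) W (GU (P v f) - G1 (P v f)) bd‖ := norm_sum_le _ _
    _ ≤ ∑ v, K * α * Real.exp (-(κ * tdist m (piB bd) v)) * F := Finset.sum_le_sum fun v _ => hblk v
    _ = K * α * F * ∑ v, Real.exp (-(κ * tdist m (piB bd) v)) := by
        rw [Finset.mul_sum]; exact Finset.sum_congr rfl fun v _ => by ring
    _ ≤ K * α * F * S := mul_le_mul_of_nonneg_left (torusSum_le d hm hκ (piB bd)) (by positivity)
    _ = K * S * α * F := by ring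

/-! ## §2 In `L²(c₀)`: `‖G₁,k(U)f − G₁,k(1)f‖ ≤ K·α·‖f‖`, lattice-free -/

include hd hL hL3 hMφ hMφ' hφ hφ' hstar ha ha' hr0 hr1 hτ hCτ hτm hMτ hρw hτ₁ hτ₂ hφτ hM₂ hrepr in
set_option maxHeartbeats 1600000 in
/-- **THE BOND-PROPAGATOR LADDER IN `L²`, LATTICE-FREE** — `∃ α₀ > 0, K ≥ 0` BEFORE `n, η, m, U`: along the class, for EVERY `f` of the weight-`c₀` fine bond carrier,
`‖G₁,k(U)f − G₁,k(1)f‖ ≤ K·α·‖f‖` — §1 through the symmetric bridge (`G₁,k(U) − G₁,k(1)` is symmetric, `G1k_isSymmetric` at `U` and at `1`). [folklore]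
[cite: Balaban1985BackgroundPropagators, Thm 3.4 p.400, Thm 3.11 p.416, (3.84)–(3.86) p.407, (3.47) p.398] -/
theorem exists_norm_G1k_sub_flat_le :
    ∃ α₀ K : ℝ, 0 < α₀ ∧ 0 ≤ K ∧
      ∀ (n : ℕ) (η : ℝ), η * (L : ℝ) ^ (n + 1) = 1 →
      ∀ (c₀ c₁ : ℝ) [Fact (0 < c₀)] [Fact (0 < c₁)], c₀ * ((L : ℝ) ^ (n + 1)) ^ d = c₁ → |η| ^ d / c₀ ≤ ρw →
      ∀ (m : Fin d → ℕ) [∀ i, NeZero (m i)], (∀ i, 1 ≤ m i) → ∀ (U : Bond d (towerP L m (n + 1)) → 𝔸ˣ) (α : ℝ), 0 ≤ α → α ≤ α₀ →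
        (∀ bd, U bd ∈ U1 𝔸) → (∀ bd, ‖(U bd : 𝔸) - 1‖ ≤ α * η) →
        (∀ (x : TSite d (towerP L m (n + 1))) (μ ν : Fin d), ‖(U (shift ν x, μ) : 𝔸) - (U (x, μ) : 𝔸)‖ ≤ α * η ^ 2) →
        (∀ p : B9SectCLatticeCarrier.Plaq d (towerP L m (n + 1)), ‖(plaqHolU U p : 𝔸) - 1‖ ≤ α * η ^ 2) →
      ∀ (hUst : ∀ bd, star (U bd : 𝔸) = (((U bd)⁻¹ : 𝔸ˣ) : 𝔸))
        (αU : ℕ → ℝ), (∀ j, 0 ≤ αU j) → ∀ (hα1 : ∀ j, αU j ≤ 1 / 64), (∑ j ∈ Finset.range (n + 1), αU j ≤ AQ) →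
        ∀ (hU1 : ∀ (j : ℕ) (x : B7Prop1Explicit.Site d) (k : Fin d), perCfg (towerP L m (j + 1)) (UlevOf L m (n + 1) U j) x k ∈ U1 𝔸)
        (hreg : ∀ (j : ℕ) (y : TSite d (towerP L m j)) (k : Fin d) (ρ' : Fin d → Fin L),
          ‖((Wcx L (perCfg (towerP L m (j + 1)) (UlevOf L m (n + 1) U j)) (cornerSite L y) k (boxVec L ρ') : 𝔸ˣ) : 𝔸) - 1‖ ≤ αU j),
      ∀ (εU : ℕ → ℝ), (∀ j, 0 ≤ εU j) → (∀ j, εU j ≤ 1) → (∀ j < n + 1, εU j ≤ α * r ^ j) →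
        (∀ (j : ℕ) (bd : Bond d (towerP L m (j + 1))), ‖(UlevOf L m (n + 1) U j bd : 𝔸) - 1‖ ≤ εU j) →
        (∀ (j : ℕ) (bd : Bond d (towerP L m (j + 1))), UlevOf L m (n + 1) U j bd ∈ U1 𝔸) →
        (∀ (j : ℕ) (bd : Bond d (towerP L m (j + 1))) (w : W), ‖adTransportW φ (UlevOf L m (n + 1) U j) bd w‖ ≤ ‖w‖) →
      ∀ (hposU' : ∀ x : SiteL2K ℂ d (towerP L m (n + 1)) c₀ W, x ≠ 0 → 0 < RCLike.re ⟪x, laplacePrimeAk L m n φ η U a' (c₁ := c₁) x⟫_ℂ)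
        (hposU : ∀ x : BondL2K ℂ d (towerP L m (n + 1)) c₀ W, x ≠ 0 →
          0 < RCLike.re ⟪x, laplaceAk L m n φ η U hL αU hα1 hU1 hreg τ (c₀ := c₀) (c₁ := c₁) a x⟫_ℂ)
        (hpos'₁ : ∀ x : SiteL2K ℂ d (towerP L m (n + 1)) c₀ W, x ≠ 0 →
          0 < RCLike.re ⟪x, laplacePrimeAk L m n φ η (fun _ : Bond d (towerP L m (n + 1)) => (1 : 𝔸ˣ)) a' (c₁ := c₁) x⟫_ℂ)
        (hpos₁ : ∀ x : BondL2K ℂ d (towerP L m (n + 1)) c₀ W, x ≠ 0 →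
          0 < RCLike.re ⟪x, laplaceAk L m n φ η (fun _ : Bond d (towerP L m (n + 1)) => (1 : 𝔸ˣ)) hL (fun _ => 0) (fun _ => by norm_num)
            (perCfg_UlevOf_one_mem_U1 L m (n + 1)) (norm_Wcx_UlevOf_one_sub_one_le L m (n + 1) (fun _ => 0) (fun _ => le_rfl)) τ
            (c₀ := c₀) (c₁ := c₁) a x⟫_ℂ)
        (f : BondL2K ℂ d (towerP L m (n + 1)) c₀ W),
        ‖G1k L m n φ η U hL αU hα1 hU1 hreg τ (c₀ := c₀) (c₁ := c₁) hposU f -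
            G1k L m n φ η (fun _ : Bond d (towerP L m (n + 1)) => (1 : 𝔸ˣ)) hL (fun _ => 0) (fun _ => by norm_num)
              (perCfg_UlevOf_one_mem_U1 L m (n + 1)) (norm_Wcx_UlevOf_one_sub_one_le L m (n + 1) (fun _ => 0) (fun _ => le_rfl)) τ
              (c₀ := c₀) (c₁ := c₁) hpos₁ f‖ ≤ K * α * ‖f‖ := by
  obtain ⟨α₀, K, hα₀, hK, H⟩ :=
    exists_supRow_G1k_sub_flat hd L hL hL3 φ hMφ hMφ' hφ hφ' hstar ha ha' hr0 hr1 τ hτ hCτ hτm hMτ hρw hτ₁ hτ₂ hφτ b hM₂ hrepr AQ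
  refine ⟨α₀, K, hα₀, hK, ?_⟩
  intro n η hηL c₀ c₁ _ _ hw hρ m _ hm U α hα hαle hUb hUη hUw hpl hUst αU hα0U hα1 hAQ hU1 hreg εU hε0 hε1 hεr hlev hlev1 hRlev hposU' hposU hpos'₁ hpos₁ f
  have hUst1 : ∀ bd : Bond d (towerP L m (n + 1)), star ((fun _ : Bond d (towerP L m (n + 1)) => (1 : 𝔸ˣ)) bd : 𝔸) =
      ((((fun _ : Bond d (towerP L m (n + 1)) => (1 : 𝔸ˣ)) bd)⁻¹ : 𝔸ˣ) : 𝔸) := fun _ => by simp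
  have hsymU := G1k_isSymmetric L hL φ τ hτ₁ hτ₂ hφτ n η m U αU hα1 hU1 hreg hUst hposU
  have hsym1 := G1k_isSymmetric L hL φ τ hτ₁ hτ₂ hφτ n η m (fun _ : Bond d (towerP L m (n + 1)) => (1 : 𝔸ˣ)) (fun _ => 0) (fun _ => by norm_num)
    (perCfg_UlevOf_one_mem_U1 L m (n + 1)) (norm_Wcx_UlevOf_one_sub_one_le L m (n + 1) (fun _ => 0) (fun _ => le_rfl)) hUst1 hpos₁
  have hsym := hsymU.sub hsym1
  have h := norm_le_of_isSymmetric_of_supLetter _ hsym (mul_nonneg hK hα) (fun g F _ hg x => by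
    have h1 := H n η hηL c₀ c₁ hw hρ m hm U α hα hαle hUb hUη hUw hpl hUst αU hα0U hα1 hAQ hU1 hreg εU hε0 hε1 hεr hlev hlev1 hRlev hposU' hposU hpos'₁ hpos₁
      g F hg x
    rwa [LinearMap.sub_apply]) f
  rwa [LinearMap.sub_apply] at h

end Literature.MathematicalPhysics.QuantumFieldTheory.Balaban1983to89.B9Eq386BondPropagatorTwoBackgroundL2Tower

end
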